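import Mathlib
import Summits.ResolutionOfSingularities.ResolutionOfSingularities.Theorems.RadicialJungCleanModelsLens5TFramePort4
import HarnessLib

/-!
# Route `RadicialJung`, crux `CleanModels` (stmt-15917): T⁗ port part 9/13 — §H THEOREM T⁗: `cleanLU3DefectPRankTwoFrame_of_ports`, `cleanLU3DefectPRankTwoFrame_of_cossartPiltant2019` (source :2469–2772; constant-frame corollaries not ported)

PORT (line lead `res-B-lead-1` g8, for Sketch rev 32) of res-B-lens-5's crux workfiles `Cruxes/DescentPerfectToAll/Lens5_TFrame.lean` rev 4
(crux ae884a356928; author res-B-lens-5 g15; `lean check` rc 0 · 0 sorries · 0 warnings; crit-1 TRIAGE-146/150 PASS) and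
`Cruxes/DescentPerfectToAll/Lens5_PDegreeCount.lean` rev 3 (crux 100289d6413b; TRIAGE-151 PASS): THEOREMS T⁗ / T⁗′ / T⁗″ / T⁗‴ — the slice
{`[Γ:pΓ] = p²`, `k` of FINITE `p`-rank `r`, `[κ_v : κ_v^p] = p^r`} of the research stub `stub_cleanLU3DefectNonDiscrete` (valuations of MINIMAL
Frobenius defect `d(K|K^p, v) = p`, ANY such ground field: no perfectness, no separability of `K/k` or `κ_v/k`), modulo F-02 `CossartPiltant2019` and
F-32 (`hEmb`) only.  The port is split into def-free modules `…Lens5TFrame{RG,IR,Graded,Port2,Port4Core,Layer,Layer2,Port4,Composition,PMon,PDegreeA,PDegreeB,PDegreeC}`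
over ONE currency module `…Lens5TFrameCurrency` (the authors' `def`s, verbatim); declarations VERBATIM, namespace
`Summit.ResolutionOfSingularities.ResolutionOfSingularities.Theorems.RadicialJungCleanModels.Lens5TFrame` (the authors' §A copy of
`Lens5_PDegreeSep` and the constant-frame corollaries `cleanLU3DefectPRankTwoSepFin_of_frame` / `…SepFin_of_cossartPiltant2019'` are not ported).
OURS · counted 0 · nothing here proves resolution in characteristic `p`.


-/

set_option linter.dupNamespace false -- mandated namespace of this single-conjunct summit

section

open IsLocalRing
open Literature.AlgebraicGeometry.Resolution
open Summit.ResolutionOfSingularities.ResolutionOfSingularities.Theorems.RadicialJung.CleanModels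
open Summit.ResolutionOfSingularities.ResolutionOfSingularities.Theorems.RadicialJung.CleanModels.Lens5
open Summit.ResolutionOfSingularities.ResolutionOfSingularities.Theorems.RadicialJung.CleanModels.Lens5.PRankTwoCurrency
open Summit.ResolutionOfSingularities.ResolutionOfSingularities.Theorems.RadicialJung.CleanModels.Lens5.PRankTwoAssembly
open Summit.ResolutionOfSingularities.ResolutionOfSingularities.Theorems.RadicialJungCleanModels.Lens5RegularityCriterion
open Summit.ResolutionOfSingularities.ResolutionOfSingularities.Theorems.RadicialJungCleanModels.Lens5ChartSurjection

namespace Summit.ResolutionOfSingularities.ResolutionOfSingularities.Theorems.RadicialJungCleanModels.Lens5TFrame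

/-! ## §H THE COMPOSITION (kernel-checked): PORTS 1⁗ (proved), 2′ (proved, over `k^p`), 3 (✓, verbatim), 4⁗ (proved, §G⁗.C) and the
exit lemma give THEOREM T⁗'s slice; T′_fin's slice is the COROLLARY `W := b` (constant frame). -/

section Composition

open AlgebraicGeometry CategoryTheory

set_option maxHeartbeats 1600000 in
/-- **THEOREM T⁗'s slice from the ports** — modulo F-02 in LU³ form (`hLU3`, applied to the field `k^p`), F-32 (`hEmb`) and the typed
commutative-algebra statement PORT 4⁗ (`hPort`, proved above as `frameChartPort`).  SORRY-FREE composition; data flow = the file header.  `hreg`, `hnd`, `htd`-free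
except in PORT 3. [folklore] -/
theorem cleanLU3DefectPRankTwoFrame_of_ports (p : ℕ) [Fact p.Prime]
    (hLU3 : ∀ (k : Type) [Field k], LocalUniformization3 k)
    (hEmb : ∀ (Z : Scheme.{0}) [IsIntegral Z] [IsNoetherian Z], Scheme.IsRegular Z →
      Scheme.IsExcellent Z → ∀ (X : Set Z), IsClosed X → X ≠ Set.univ → topologicalKrullDim X ≤ 2 →
        ∃ (Z' : Scheme.{0}) (π : Z' ⟶ Z), IsProper π ∧ Function.Surjective π.base ∧
          (∃ U : Z.Opens, (U : Set Z) = Xᶜ ∧ IsIso (π ∣_ U)) ∧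
          IsStrictNormalCrossingsDivisor Z' (π.base ⁻¹' X))
    (hPort : FrameChartPort p) :
    CleanLU3DefectPRankTwoFrameAt p := by
  intro k _ _ K _ _ O A hAO hAfg hFrac hdimA hreg hdim3 hzd g₀ hg₀ hdefect htd hnd hP2 Sb _ b hb S _ W hWO hPI hWmul hW1 hdegW
  classical
  haveI := hFrac
  have hp : p.Prime := Fact.out
  haveI : CharP K p := charP_of_injective_algebraMap (algebraMap k K).injective p
  have hk : ∀ c : k, algebraMap k K c ∈ O := fun c => hAO (A.algebraMap_mem c)
  -- `v W_s = 1` (residual `p`-independence)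
  have hWv : ∀ s, O.valuation (W s) = 1 := valuation_eq_one_of_residuallyPIndependentFamily O W hPI
  -- §1⁗ graded data in the frame
  obtain ⟨M, hM, hg₀M, hpM, hV, hRG, x, y, hx, hy, hvx, hvy, hP, hLI, cf, hcfM, hsum, hcfO⟩ :=
    port_gradedDataFrame p O g₀ hg₀ hdefect hP2 W hPI hWmul hW1 hdegW
  -- ## re-base `A` to the subfield `k₀ = k^p` (over which it is still finitely generated: `k = Σ_s k₀ b_s`)
  set k₀ : Subfield k := (frobenius k p).fieldRange with hk₀def
  letI : Algebra k₀ K := Algebra.compHom K k₀.subtype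
  haveI inst1 := IsScalarTower.of_algebraMap_eq (R := k₀) (S := k) (A := K) (fun _ => rfl)
  have halg₀ : ∀ c : k₀, algebraMap k₀ K c = algebraMap k K (c : k) := fun _ => rfl
  set B : Sb → K := fun s => algebraMap k K (b s) with hBdef
  let A₀ : Subalgebra k₀ K := A.restrictScalars k₀
  have hmemA₀ : ∀ x : K, x ∈ A₀ ↔ x ∈ A := fun _ => Subalgebra.mem_restrictScalars k₀
  obtain ⟨t, ht⟩ := hAfg
  set t₀ : Finset K := t ∪ Finset.univ.image B with ht₀def
  have hBt₀ : ∀ s, B s ∈ (t₀ : Set K) := fun s => by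
    rw [ht₀def, Finset.coe_union]; exact Or.inr (Finset.mem_coe.mpr (Finset.mem_image_of_mem B (Finset.mem_univ s)))
  have htt₀ : ∀ y ∈ (t : Set K), y ∈ (t₀ : Set K) := fun y hy => by
    rw [ht₀def, Finset.coe_union]; exact Or.inl hy
  have ht₀ : Algebra.adjoin k₀ (t₀ : Set K) = A₀ := by
    apply le_antisymm
    · refine Algebra.adjoin_le ?_
      intro x hx
      rw [ht₀def, Finset.coe_union] at hx
      rcases hx with hx | hx
      · exact (hmemA₀ _).mpr (by rw [← ht]; exact Algebra.subset_adjoin hx)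
      · obtain ⟨s, -, rfl⟩ := Finset.mem_image.mp (Finset.mem_coe.mp hx)
        exact (hmemA₀ _).mpr (A.algebraMap_mem (b s))
    · intro x hx
      have hx' : x ∈ Algebra.adjoin k (t : Set K) := by rw [ht]; exact (hmemA₀ x).mp hx
      have hBad : ∀ s, B s ∈ Algebra.adjoin k₀ (t₀ : Set K) := fun s => Algebra.subset_adjoin (hBt₀ s)
      clear hx
      induction hx' using Algebra.adjoin_induction with
      | mem y hy => exact Algebra.subset_adjoin (htt₀ y hy)
      | algebraMap c =>
        obtain ⟨d, hd⟩ := hb c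
        rw [hd, map_sum]
        refine sum_mem fun i _ => ?_
        have hdi : algebraMap k K (d i ^ p) =
            algebraMap k₀ K ⟨d i ^ p, RingHom.mem_fieldRange.mpr ⟨d i, frobenius_def _ _⟩⟩ := by
          rw [halg₀]
        rw [map_mul, hdi]
        exact mul_mem (Subalgebra.algebraMap_mem _ _) (hBad i)
      | add y z _ _ hy hz => exact add_mem hy hz
      | mul y z _ _ hy hz => exact mul_mem hy hz
  have hA₀fg : A₀.FG := ⟨t₀, ht₀⟩
  haveI hfr₀ : IsFractionRing A₀ K := ‹IsFractionRing A K›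
  have hdimA₀ : ringKrullDim A₀ ≤ 3 := hdimA
  have hA₀O : A₀.toSubring ≤ O.toSubring := hAO
  have hdim3₀ : ringKrullDim (locAtCentre A₀.toSubring O) = 3 := hdim3
  have hzd₀ : ∀ (T : Subring K) (hT : T ≤ O.toSubring), A₀.toSubring ≤ T → (subringCentre T O hT).IsMaximal := hzd
  have ht₀A : ∀ a ∈ t₀, a ∈ A := fun a ha =>
    (hmemA₀ a).mp (by rw [← ht₀]; exact Algebra.subset_adjoin (Finset.mem_coe.mpr ha))
  -- ## the twist-field identification over `k₀` (memo §10 patch: constants of `k₀` ARE `p`-th powers in `K`)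
  have htwist : ∀ g₁ : K, (IntermediateField.adjoin k₀ ((fun x : K => x ^ p) '' (t₀ : Set K) ∪ {g₁})).toSubfield =
      Subfield.closure (Set.range (frobenius K p) ∪ {g₁}) := by
    intro g₁
    rw [TwistModel.adjoin_twist_toSubfield_eq p A₀ (t₀ : Set K) ht₀ g₁]
    apply le_antisymm
    · apply Subfield.closure_le.mpr
      rintro x ((hx | hx) | hx)
      · obtain ⟨c, rfl⟩ := hx
        obtain ⟨d, hd⟩ := RingHom.mem_fieldRange.mp c.2
        refine Subfield.subset_closure (Or.inl ⟨algebraMap k K d, ?_⟩)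
        rw [frobenius_def, ← map_pow, ← frobenius_def, hd, halg₀]
      · exact Subfield.subset_closure (Or.inl hx)
      · exact Subfield.subset_closure (Or.inr hx)
    · exact Subfield.closure_mono (Set.union_subset_union_left _ Set.subset_union_right)
  -- ## the generator list `tW := {1} ∪ t₀ ∪ W ∪ W·W` (all in `O`)
  set tW : Finset K := insert 1 (t₀ ∪ Finset.univ.image W ∪ Finset.univ.image (fun q : S × S => W q.1 * W q.2)) with htWdef
  have h1tW : (1 : K) ∈ tW := by rw [htWdef]; exact Finset.mem_insert_self _ _
  have ht₀W : ∀ a ∈ t₀, a ∈ tW := fun a ha => by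
    rw [htWdef]; exact Finset.mem_insert_of_mem (Finset.mem_union_left _ (Finset.mem_union_left _ ha))
  have hWtW : ∀ s, W s ∈ tW := fun s => by
    rw [htWdef]
    exact Finset.mem_insert_of_mem (Finset.mem_union_left _ (Finset.mem_union_right _
      (Finset.mem_image.mpr ⟨s, Finset.mem_univ _, rfl⟩)))
  have hWWtW : ∀ s s' : S, W s * W s' ∈ tW := fun s s' => by
    rw [htWdef]
    exact Finset.mem_insert_of_mem (Finset.mem_union_right _ (Finset.mem_image.mpr ⟨(s, s'), Finset.mem_univ _, rfl⟩))
  have htWcases : ∀ a ∈ tW, a = 1 ∨ a ∈ t₀ ∨ (∃ s, a = W s) ∨ (∃ s s' : S, a = W s * W s') := by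
    intro a ha
    rw [htWdef, Finset.mem_insert, Finset.mem_union, Finset.mem_union] at ha
    rcases ha with rfl | (ha | ha) | ha
    · exact Or.inl rfl
    · exact Or.inr (Or.inl ha)
    · obtain ⟨s, -, rfl⟩ := Finset.mem_image.mp ha
      exact Or.inr (Or.inr (Or.inl ⟨s, rfl⟩))
    · obtain ⟨q, -, rfl⟩ := Finset.mem_image.mp ha
      exact Or.inr (Or.inr (Or.inr ⟨q.1, q.2, rfl⟩))
  have htWO : ∀ a ∈ tW, a ∈ O := by
    intro a ha
    rcases htWcases a ha with rfl | ha | ⟨s, rfl⟩ | ⟨s, s', rfl⟩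
    · exact O.one_mem
    · exact hAO (ht₀A a ha)
    · exact hWO s
    · exact mul_mem (hWO s) (hWO s')
  have hA₀tW : A₀ ≤ Algebra.adjoin k₀ (tW : Set K) := by
    rw [← ht₀]
    exact Algebra.adjoin_mono fun a ha => Finset.mem_coe.mpr (ht₀W a (Finset.mem_coe.mp ha))
  -- ## the finite set to monomialise: `x^p`, `y^p` and the non-zero graded coefficients of the members of `tW`
  set F : Finset K := (insert (x ^ p) (insert (y ^ p)
    ((tW ×ˢ (Finset.univ : Finset (S × (Fin p × Fin p)))).image (fun q => cf q.1 q.2)))).filter (fun f => f ≠ 0)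
    with hFdef
  have hFM : ∀ f ∈ F, f ∈ M := by
    intro f hf
    rw [hFdef, Finset.mem_filter, Finset.mem_insert, Finset.mem_insert, Finset.mem_image] at hf
    rcases hf with ⟨rfl | rfl | ⟨q, hq, rfl⟩, -⟩
    · exact hpM x
    · exact hpM y
    · exact hcfM q.1 q.2
  have hF0 : ∀ f ∈ F, f ≠ 0 := fun f hf => (Finset.mem_filter.mp hf).2
  have hxpF : x ^ p ∈ F := Finset.mem_filter.mpr ⟨by simp, pow_ne_zero _ hx⟩
  have hypF : y ^ p ∈ F := Finset.mem_filter.mpr ⟨by simp, pow_ne_zero _ hy⟩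
  have hcfF : ∀ a ∈ tW, ∀ l, cf a l ≠ 0 → cf a l ∈ F := by
    intro a ha l hne
    refine Finset.mem_filter.mpr ⟨Finset.mem_insert_of_mem (Finset.mem_insert_of_mem ?_), hne⟩
    exact Finset.mem_image.mpr ⟨(a, l), Finset.mem_product.mpr ⟨ha, Finset.mem_univ _⟩, rfl⟩
  -- §2′ the monomialising `k₀`-model `T := locAtCentre A₂ O ⊆ M` (Port 2b core over `k₀`; consumes F-02 at `k^p` and F-32)
  obtain ⟨A₂, hA₂O, hA₂fg, hAp, hR₂M, hreg₂, z₂, hspan₂, hdimR₂, hz0, hfac⟩ :=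
    port_monomialModel_core p (hLU3 _) hEmb O A₀ hA₀O hA₀fg hdimA₀ hdim3₀ hzd₀ t₀ ht₀ htwist g₀ M hM F hFM hF0
  haveI := hreg₂
  -- `K`-valued parameters
  set z : Fin 3 → K := fun i => (z₂ i : K) with hzdef
  have hzT : ∀ i, z i ∈ locAtCentre A₂.toSubring O := fun i => (z₂ i).2
  have hz0' : ∀ i, z i ≠ 0 := fun i => hz0 i
  have hzv : ∀ i, O.valuation (z i) < 1 := by
    intro i
    have hi : z₂ i ∈ maximalIdeal _ := by rw [← hspan₂]; exact Ideal.subset_span ⟨i, rfl⟩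
    exact (mem_maximalIdeal_locAtCentre_iff hA₂O _).mp hi
  have hzspan : ∀ r : K, r ∈ locAtCentre A₂.toSubring O → O.valuation r < 1 →
      ∃ b : Fin 3 → K, (∀ i, b i ∈ locAtCentre A₂.toSubring O) ∧ r = ∑ i, b i * z i := by
    intro r hr hvr
    have hm : (⟨r, hr⟩ : locAtCentre A₂.toSubring O) ∈ maximalIdeal _ :=
      (mem_maximalIdeal_locAtCentre_iff hA₂O _).mpr hvr
    rw [← hspan₂, Ideal.mem_span_range_iff_exists_fun] at hm
    obtain ⟨b, hb⟩ := hm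
    refine ⟨fun i => (b i : K), fun i => (b i).2, ?_⟩
    have h := congrArg (fun w : locAtCentre A₂.toSubring O => (w : K)) hb
    simp only at h
    rw [← h]
    push_cast
    rfl
  have hfac' : ∀ f ∈ F, ∃ (ε : K) (e : Fin 3 → ℤ), ε ∈ locAtCentre A₂.toSubring O ∧ O.valuation ε = 1 ∧
      f = ε * ∏ i, z i ^ e i := hfac
  choose! ε ex hεT hεv hfeq using hfac'
  have hzM : ∀ i, z i ∈ M := fun i => hR₂M _ (hzT i)
  have hzV : ∀ i, ∃ w : K, w ≠ 0 ∧ O.valuation (z i) = O.valuation (w ^ p) := fun i => hV _ (hzM i) (hz0' i)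
  have hxA : x ^ p = ε (x ^ p) * ∏ i, z i ^ ex (x ^ p) i := hfeq _ hxpF
  have hyB : y ^ p = ε (y ^ p) * ∏ i, z i ^ ex (y ^ p) i := hfeq _ hypF
  -- exponent data of the non-zero graded pieces (the frame factor `W_s` is a `v`-unit and is dropped)
  set pieces : Finset (K × (S × (Fin p × Fin p))) := (tW ×ˢ Finset.univ).filter (fun q => cf q.1 q.2 ≠ 0) with hpieces
  set E : Finset ((Fin 3 → ℤ) × (Fin p × Fin p)) := pieces.image (fun q => (ex (cf q.1 q.2), q.2.2)) with hEdef
  have hE : ∀ e ∈ E, O.valuation ((∏ i, z i ^ e.1 i) * (x ^ (e.2.1 : ℕ) * y ^ (e.2.2 : ℕ))) ≤ 1 := by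
    intro e he
    obtain ⟨q, hq, rfl⟩ := Finset.mem_image.mp he
    obtain ⟨hq1, hq2⟩ := Finset.mem_filter.mp hq
    have hat : q.1 ∈ tW := (Finset.mem_product.mp hq1).1
    have hF' : cf q.1 q.2 ∈ F := hcfF q.1 hat q.2 hq2
    have hval : O.valuation (cf q.1 q.2 * (W q.2.1 * (x ^ (q.2.2.1 : ℕ) * y ^ (q.2.2.2 : ℕ)))) ≤ 1 :=
      (O.valuation_le_one_iff _).mpr (hcfO q.1 (htWO q.1 hat) q.2)
    rw [hfeq _ hF', map_mul, map_mul, map_mul, hεv _ hF', hWv, one_mul, one_mul, ← map_mul] at hval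
    simpa using hval
  -- §3 the toric chart (✓ PORT 3, VERBATIM; `k`-facing only through `htd`)
  obtain ⟨ρ, hρ, c, a, b', u, ha, hb', hu, hupos, huzero, hzu, hEu⟩ :=
    port_toricChart p O A hAO ⟨t, ht⟩ hdimA hdim3 htd hx hy hP z hz0' hzv hzV (ε (x ^ p)) (ε (y ^ p))
      (hεv _ hxpF) (hεv _ hypF) (ex (x ^ p)) (ex (y ^ p)) hxA hyB E hE
  -- (PB0): the value-zero chart monomials involve no `x`, `y`, hence lie in `M`
  have hab0 : ∀ j : Fin 3, ρ ≤ (j : ℕ) → a j = 0 ∧ b' j = 0 := by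
    intro j hj
    obtain ⟨W', hW0, hW'⟩ := exists_valuation_prod_zpow_eq O z hzV (c j)
    exact exponents_eq_zero_of_valuation_eq_one O hP (ha j) (hb' j) hW0 hW' (by rw [← hu j]; exact huzero j hj)
  have huM : ∀ j : Fin 3, ρ ≤ (j : ℕ) → u j ∈ M := by
    intro j hj
    obtain ⟨ha0, hb0⟩ := hab0 j hj
    rw [hu j, ha0, hb0, pow_zero, pow_zero, mul_one, mul_one]
    exact prod_mem fun i _ => zpow_mem (hzM i) _
  have hu0 : ∀ j, u j ≠ 0 := by
    intro j
    rw [hu j]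
    exact mul_ne_zero (Finset.prod_ne_zero_iff.mpr fun i _ => zpow_ne_zero _ (hz0' i))
      (mul_ne_zero (pow_ne_zero _ hx) (pow_ne_zero _ hy))
  have hupres : ∀ j : Fin 3, ∃ (e : Fin 3 → ℤ) (a₁ b₁ : ℕ), u j = (∏ i, z i ^ e i) * (x ^ a₁ * y ^ b₁) :=
    fun j => ⟨c j, a j, b' j, hu j⟩
  -- the unit factors `α^i β^j` are units of `T`
  have hunit : ∀ (ia ib : ℤ), ε (x ^ p) ^ ia * ε (y ^ p) ^ ib ∈ locAtCentre A₂.toSubring O ∧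
      O.valuation (ε (x ^ p) ^ ia * ε (y ^ p) ^ ib) = 1 := fun ia ib =>
    ⟨mul_mem (zpow_mem_locAtCentre (hεT _ hxpF) (hεv _ hxpF) ia)
        (zpow_mem_locAtCentre (hεT _ hypF) (hεv _ hypF) ib),
      by rw [map_mul, map_zpow₀, map_zpow₀, hεv _ hxpF, hεv _ hypF, one_zpow, one_zpow, one_mul]⟩
  have hzu' : ∀ i : Fin 3, ∃ (ε' : K) (d : Fin 3 → ℤ), ε' ∈ locAtCentre A₂.toSubring O ∧ O.valuation ε' = 1 ∧
      (∀ j : Fin 3, (j : ℕ) < ρ → 0 ≤ d j) ∧ (∃ j : Fin 3, (j : ℕ) < ρ ∧ 0 < d j) ∧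
      z i = ε' * ∏ j, u j ^ d j := by
    intro i
    obtain ⟨d, ia, ib, hd, hdpos, hzi⟩ := hzu i
    exact ⟨_, d, (hunit ia ib).1, (hunit ia ib).2, hd, hdpos, hzi⟩
  -- the members of `tW` as unit-weighted sums of frame-chart monomials with `d_{<ρ} ≥ 0`
  choose! dE iaE ibE hdE hkerE hmonE using hEu
  have htu' : ∀ a₀ ∈ tW, ∃ (ν : S × (Fin p × Fin p) → K) (d : S × (Fin p × Fin p) → Fin 3 → ℤ),
      (∀ l, ν l = 0 ∨ (ν l ∈ locAtCentre A₂.toSubring O ∧ O.valuation (ν l) = 1)) ∧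
      (∀ l, ∀ j : Fin 3, (j : ℕ) < ρ → 0 ≤ d l j) ∧ a₀ = ∑ l, ν l * W (Prod.fst l) * ∏ j, u j ^ d l j := by
    intro a₀ ha₀
    have hmemE : ∀ l, cf a₀ l ≠ 0 → (ex (cf a₀ l), l.2) ∈ E := fun l hne =>
      Finset.mem_image.mpr ⟨(a₀, l), Finset.mem_filter.mpr ⟨Finset.mem_product.mpr ⟨ha₀, Finset.mem_univ _⟩, hne⟩, rfl⟩
    refine ⟨fun l => if cf a₀ l = 0 then 0 else
        ε (cf a₀ l) * (ε (x ^ p) ^ iaE (ex (cf a₀ l), l.2) * ε (y ^ p) ^ ibE (ex (cf a₀ l), l.2)),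
      fun l => if cf a₀ l = 0 then 0 else dE (ex (cf a₀ l), l.2), ?_, ?_, ?_⟩
    · intro l
      by_cases h0 : cf a₀ l = 0
      · exact Or.inl (by simp [h0])
      · refine Or.inr ?_
        simp only [h0, if_false]
        have hF' := hcfF a₀ ha₀ l h0
        exact ⟨mul_mem (hεT _ hF') (hunit _ _).1,
          by rw [map_mul, hεv _ hF', (hunit _ _).2, one_mul]⟩
    · intro l j hj
      by_cases h0 : cf a₀ l = 0
      · simp [h0]
      · simp only [h0, if_false]
        exact hdE _ (hmemE l h0) j hj
    · conv_lhs => rw [← hsum a₀]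
      refine Finset.sum_congr rfl fun l _ => ?_
      by_cases h0 : cf a₀ l = 0
      · simp [h0]
      · simp only [h0, if_false]
        have hF' := hcfF a₀ ha₀ l h0
        have hmon := hmonE _ (hmemE l h0)
        simp only at hmon
        calc cf a₀ l * (W l.1 * (x ^ (l.2.1 : ℕ) * y ^ (l.2.2 : ℕ)))
            = (ε (cf a₀ l) * ∏ i, z i ^ ex (cf a₀ l) i) * (W l.1 * (x ^ (l.2.1 : ℕ) * y ^ (l.2.2 : ℕ))) := by
              rw [← hfeq _ hF']
          _ = ε (cf a₀ l) * W l.1 * ((∏ i, z i ^ ex (cf a₀ l) i) * (x ^ (l.2.1 : ℕ) * y ^ (l.2.2 : ℕ))) := by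
              ring
          _ = ε (cf a₀ l) * (ε (x ^ p) ^ iaE (ex (cf a₀ l), l.2) * ε (y ^ p) ^ ibE (ex (cf a₀ l), l.2)) *
                W l.1 * ∏ j, u j ^ dE (ex (cf a₀ l), l.2) j := by
              rw [hmon]; ring
  -- §G⁗ the regular frame-chart algebra and its regular parameter in `M` (the typed obligation PORT 4⁗)
  obtain ⟨A'', hA''O, hA₀A'', hA''fg, hreg'', ψ, hψ1, hψ2, hψM⟩ :=
    hPort k₀ K O A₀ hA₀O hA₀fg hfr₀ hdimA₀ hdim3₀ hzd₀ M A₂ hA₂O hA₂fg hAp hR₂M hreg₂ hdimR₂ z hzT hz0' hzv hzspan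
      S W hWO hWv hRG x y hx hy (hpM x) (hpM y) hvx hvy hLI hV hP
      (fun m hm l₀ => valuation_term_le_double_sum hp O M hV W hWv hRG hx hy hP m hm l₀)
      tW htWO hA₀tW h1tW hWtW hWWtW ρ hρ u hu0 hupos huzero huM hupres hzu'
      (S × (Fin p × Fin p)) Prod.fst htu'
  -- ## back to `k`: the same subring is a finitely generated `k`-subalgebra containing `A`
  obtain ⟨gens, hgens⟩ := hA''fg
  let A''k : Subalgebra k K :=
    { toSubsemiring := A''.toSubsemiring
      algebraMap_mem' := fun c₁ => hA₀A'' ((hmemA₀ _).mpr (A.algebraMap_mem c₁)) }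
  have hmemA''k : ∀ w : K, w ∈ A''k ↔ w ∈ A'' := fun _ => Iff.rfl
  have hAA'' : A ≤ A''k := fun w hw => (hmemA''k w).mpr (hA₀A'' ((hmemA₀ w).mpr hw))
  have hA''kfg : A''k.FG := by
    refine ⟨gens, le_antisymm ?_ ?_⟩
    · refine Algebra.adjoin_le ?_
      intro g hg
      rw [SetLike.mem_coe, hmemA''k, ← hgens]
      exact Algebra.subset_adjoin hg
    · intro w hw
      have hw' : w ∈ Algebra.adjoin k₀ (gens : Set K) := by rw [hgens]; exact (hmemA''k w).mp hw
      have hle : Algebra.adjoin k₀ (gens : Set K) ≤ (Algebra.adjoin k (gens : Set K)).restrictScalars k₀ :=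
        Algebra.adjoin_le fun g hg => Algebra.subset_adjoin hg
      exact (Subalgebra.mem_restrictScalars k₀).mp (hle hw')
  have hA''kO : A''k.toSubring ≤ O.toSubring := fun w hw => hA''O hw
  -- exit: clean form (3) (✓ VERBATIM)
  obtain ⟨cM, hcM⟩ := (hM _).mp hψM
  exact cleanLUConcl_of_parameter O A A''k hA''kO hAA'' hA''kfg hreg'' g₀ ψ hψ1 hψ2 cM hcM

/-- **THEOREM T⁗** (rev 2): F-02 consumed in its main-theorem form `CossartPiltant2019` (✓ `CossartPiltant2019.lu3`) and PORT 4⁗ DISCHARGED by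
`frameChartPort` — the frame slice modulo F-32 (`hEmb`) alone. [folklore] -/
theorem cleanLU3DefectPRankTwoFrame_of_cossartPiltant2019 (p : ℕ) [Fact p.Prime]
    (hCP : CossartPiltant2019.{0})
    (hEmb : ∀ (Z : Scheme.{0}) [IsIntegral Z] [IsNoetherian Z], Scheme.IsRegular Z →
      Scheme.IsExcellent Z → ∀ (X : Set Z), IsClosed X → X ≠ Set.univ → topologicalKrullDim X ≤ 2 →
        ∃ (Z' : Scheme.{0}) (π : Z' ⟶ Z), IsProper π ∧ Function.Surjective π.base ∧
          (∃ U : Z.Opens, (U : Set Z) = Xᶜ ∧ IsIso (π ∣_ U)) ∧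
          IsStrictNormalCrossingsDivisor Z' (π.base ⁻¹' X))
    : CleanLU3DefectPRankTwoFrameAt p :=
  cleanLU3DefectPRankTwoFrame_of_ports p (fun k _ => hCP.lu3 k) hEmb (frameChartPort p)


end Composition

end Summit.ResolutionOfSingularities.ResolutionOfSingularities.Theorems.RadicialJungCleanModels.Lens5TFrame

end
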